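import Summits.MatrixMultiplication.MatrixMultiplication.Theorems.FarEdgeDescentStrassenFloor
import HarnessLib

/-!
# Far-edge descent, kernel XXXIX-B: the SHIFT/DIAGONAL pair — `2L + ∑_{i∈S} (kᵢ−1)mᵢ ≤ 2R̲(⊕⟨kᵢ,mᵢ,kᵢ⟩)`, and the uniform floor `4L ≤ 3R̲`

Route `FarEdgeDescent`, special leaf `FiniteSaturation` (stmt-MatrixMultiplication-23739): helper
kernel, THESES-FREE (decomp-mm lens 2 «structural dichotomy: special vs generic», gen 59).

Kernel XXXIX-A (`FarEdgeDescentStrassenFloor.floor`) ran Strassen's equation (BCS Thm. 19.12) with the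
matrix-unit pair `E₁₀, E₀₁`, whose commutator has rank `2mᵢ` per selected block: surplus `mᵢ`, i.e. a
RELATIVE surplus `1/kᵢ` of the block's `x`-mass `kᵢmᵢ` — sharp for `kᵢ = 2`, weak for wide blocks.  This
file runs the same equation with the characteristic-free pair

  `N = ∑_{r≥1} E_{r,r−1}` (nilpotent shift),  `D = diag(0, 1, 2, …)`   in the blocks of `S`:

`DN − ND = N` (consecutive diagonal entries differ by `1` in every characteristic), and the shift slice has
rank `≥ ∑_{i∈S} (kᵢ−1)mᵢ` (`N Nᵀ` is the `0/1` diagonal on rows `≥ 1`), so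

* `floor_shift`:   `2∑ᵢ kᵢmᵢ + ∑_{i∈S} (kᵢ − 1)mᵢ ≤ 2R̲(⊕ᵢ⟨kᵢ,mᵢ,kᵢ⟩)` — relative surplus `(kᵢ−1)/(2kᵢ)`,
  tending to Strassen's `1/2` for wide blocks (no hypothesis on the widths: trivial blocks contribute `0`);
* `uniform_floor`:  `4∑ᵢ kᵢmᵢ ≤ 3R̲(⊕ᵢ⟨kᵢ,mᵢ,kᵢ⟩)` whenever every block has `kᵢ ≥ 2` — adding the unit-pair
  floor (`L + M ≤ R̲`, `M = ∑mᵢ`) to the shift floor (`2L + (L − M) ≤ 2R̲`): **every direct sum of genuine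
  matrix products with symmetric outer format has border rank at least `4/3` of its `x`-count**, uniformly
  in the widths, over every field.

(For `kᵢ ≡ 3` both pairs give `4L/3`; the cyclic-permutation/`diag(X^r)` pair of BCS Cor. (19.14) would give
Strassen's `3L/2` for all widths after a scalar extension — not formalised here.)  The companion file
`FarEdgeDescentStrassenFloorReadout` turns `4L ≤ 3R̲` into `β ≥ 4/3` for the budget factor of the
anchor-budget dial.

SCOPE / HONESTY.  As for XXXIX-A: an explicit instance of BCS (19.12)/(19.13) on the tree's `matMulDirectSum`
declaration; the shift/diagonal pair is the standard characteristic-free witness (`[D, N] = N`).  Definitions: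
only the coefficient tables `gN`, `gNt`, `gD`.

## References
* P. Bürgisser, M. Clausen, M. A. Shokrollahi, *Algebraic Complexity Theory*, Springer 1997, Thm. (19.12),
  Cor. (19.13)–(19.14). [BurgisserClausenShokrollahi1997]
* M. Bläser, *Fast Matrix Multiplication*, ToC Graduate Surveys 5 (2013), Def. 6.1, §7. [Blaser2013]
-/

noncomputable section

open scoped BigOperators Matrix
open Matrix

set_option linter.dupNamespace false

namespace Summit.MatrixMultiplication.MatrixMultiplication.Theorems.FarEdgeDescentStrassenFloorShift

open Literature.Computability.AlgebraicComplexity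
open Summit.MatrixMultiplication.MatrixMultiplication.Theorems.FarEdgeDescentStrassenFloor

variable (K : Type) [Field K] {p : ℕ}

/-! ## §1 The shift and diagonal tables -/

/-- Coefficient table of the nilpotent shift `N = ∑_{r≥1} z⁽ⁱ⁾_{r,r−1}` in the blocks `i ∈ S`. -/
def gN (S : Finset (Fin p)) : Fin p → ℕ → ℕ → K :=
  fun i r s => if i ∈ S ∧ r = s + 1 then 1 else 0

/-- Coefficient table of the transposed shift `Nᵀ = ∑_{r≥1} z⁽ⁱ⁾_{r−1,r}` in the blocks `i ∈ S`. -/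
def gNt (S : Finset (Fin p)) : Fin p → ℕ → ℕ → K :=
  fun i r s => if i ∈ S ∧ s = r + 1 then 1 else 0

/-- Coefficient table of the diagonal `D = ∑_r r · z⁽ⁱ⁾_{r,r}` in the blocks `i ∈ S`. -/
def gD (S : Finset (Fin p)) : Fin p → ℕ → ℕ → K :=
  fun i r s => if i ∈ S ∧ r = s then (r : K) else 0

/-- Entry formula of the shift slice. [cite: BurgisserClausenShokrollahi1997, Thm. (19.12)] -/
theorem slice_gN_apply (k m : Fin p → ℕ) (S : Finset (Fin p)) (x x' : Σ i, Fin (k i) × Fin (m i)) :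
    slice K k m (gN K S) x x' =
      if (x.1 = x'.1 ∧ (x.2.2 : ℕ) = x'.2.2) ∧ (x.1 ∈ S ∧ (x.2.1 : ℕ) = x'.2.1 + 1) then 1 else 0 := by
  rw [slice_apply]
  simp only [gN]
  by_cases h : x.1 = x'.1 ∧ (x.2.2 : ℕ) = x'.2.2
  · rw [if_pos h]
    simp only [h, true_and]
  · rw [if_neg h, if_neg (fun h' => h h'.1)]

/-- Entry formula of the transposed shift slice. [cite: BurgisserClausenShokrollahi1997, Thm. (19.12)] -/
theorem slice_gNt_apply (k m : Fin p → ℕ) (S : Finset (Fin p)) (x x' : Σ i, Fin (k i) × Fin (m i)) :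
    slice K k m (gNt K S) x x' =
      if (x.1 = x'.1 ∧ (x.2.2 : ℕ) = x'.2.2) ∧ (x.1 ∈ S ∧ (x'.2.1 : ℕ) = x.2.1 + 1) then 1 else 0 := by
  rw [slice_apply]
  simp only [gNt]
  by_cases h : x.1 = x'.1 ∧ (x.2.2 : ℕ) = x'.2.2
  · rw [if_pos h]
    simp only [h, true_and]
  · rw [if_neg h, if_neg (fun h' => h h'.1)]

/-- The diagonal slice is the diagonal matrix `x = (i;κ,μ) ↦ [i ∈ S]·κ`.
[cite: BurgisserClausenShokrollahi1997, Thm. (19.12)] -/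
theorem slice_gD_diag (k m : Fin p → ℕ) (S : Finset (Fin p)) :
    Matrix.of (slice K k m (gD K S)) =
      diagonal (fun x => if x.1 ∈ S then ((x.2.1 : ℕ) : K) else 0) := by
  classical
  ext x x'
  rw [of_apply, slice_apply, diagonal_apply]
  simp only [gD]
  by_cases hxx : x = x'
  · subst hxx
    by_cases hS : x.1 ∈ S
    · simp [hS]
    · simp [hS]
  · rw [if_neg hxx]
    split_ifs with h1 h2
    · exact absurd ((sigma_eq_iff x x').2 ⟨h1.1, h2.2, h1.2⟩) hxx
    · rfl
    · rfl

/-! ## §2 `N Nᵀ`, `[D, N] = N`, and the rank of the shift slice -/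

/-- `N · Nᵀ` is the `0/1` diagonal matrix supported on the rows `κ ≥ 1` of the selected blocks.
[cite: BurgisserClausenShokrollahi1997, Thm. (19.12)] -/
theorem slice_gN_mul_gNt (k m : Fin p → ℕ) (S : Finset (Fin p)) :
    Matrix.of (slice K k m (gN K S)) * Matrix.of (slice K k m (gNt K S)) =
      diagonal (fun x => if x.1 ∈ S ∧ 1 ≤ (x.2.1 : ℕ) then (1 : K) else 0) := by
  classical
  ext x x''
  rw [mul_apply, diagonal_apply]
  simp only [of_apply, slice_gN_apply, slice_gNt_apply]
  by_cases H : x.1 ∈ S ∧ 1 ≤ (x.2.1 : ℕ)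
  · have hlt : (x.2.1 : ℕ) - 1 < k x.1 := by have := x.2.1.isLt; omega
    set x₀ : (Σ i, Fin (k i) × Fin (m i)) := ⟨x.1, (⟨(x.2.1 : ℕ) - 1, hlt⟩, x.2.2)⟩ with hx₀
    have e0 : ((x₀.2.1 : ℕ)) + 1 = x.2.1 := Nat.sub_add_cancel H.2
    rw [Finset.sum_eq_single_of_mem x₀ (Finset.mem_univ _)]
    · have h1 : ((x.1 = x₀.1 ∧ (x.2.2 : ℕ) = x₀.2.2) ∧ (x.1 ∈ S ∧ (x.2.1 : ℕ) = x₀.2.1 + 1)) :=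
        ⟨⟨rfl, rfl⟩, H.1, e0.symm⟩
      rw [if_pos h1, one_mul]
      by_cases hxx : x = x''
      · subst hxx
        rw [if_pos rfl, if_pos H, if_pos ⟨⟨rfl, rfl⟩, H.1, e0.symm⟩]
      · rw [if_neg hxx, ite_eq_right_iff]
        rintro ⟨⟨h1', h2'⟩, -, h4'⟩
        exact absurd ((sigma_eq_iff x x'').2 ⟨h1', by omega, h2'⟩) hxx
    · intro y _ hne
      have hz : (if (x.1 = y.1 ∧ (x.2.2 : ℕ) = y.2.2) ∧ (x.1 ∈ S ∧ (x.2.1 : ℕ) = y.2.1 + 1)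
          then (1 : K) else 0) = 0 := by
        rw [ite_eq_right_iff]
        rintro ⟨⟨h1', h2'⟩, -, h4'⟩
        refine absurd ((sigma_eq_iff y x₀).2 ⟨h1'.symm, ?_, h2'.symm⟩) hne
        show (y.2.1 : ℕ) = (x.2.1 : ℕ) - 1
        omega
      rw [hz, zero_mul]
  · have hd : (if x.1 ∈ S ∧ 1 ≤ (x.2.1 : ℕ) then (1 : K) else 0) = 0 := if_neg H
    rw [hd, ite_self]
    refine Finset.sum_eq_zero fun y _ => ?_
    have hz : (if (x.1 = y.1 ∧ (x.2.2 : ℕ) = y.2.2) ∧ (x.1 ∈ S ∧ (x.2.1 : ℕ) = y.2.1 + 1)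
        then (1 : K) else 0) = 0 := by
      rw [ite_eq_right_iff]
      rintro ⟨-, h3', h4'⟩
      exact absurd ⟨h3', by omega⟩ H
    rw [hz, zero_mul]

/-- **`[D, N] = N`** slice-wise: `D·N − N·D = N`, because the diagonal entries of `D` at the row and the
column of a non-zero entry of `N` differ by exactly `1` — in every characteristic.
[cite: BurgisserClausenShokrollahi1997, Cor. (19.14) (proof)] -/
theorem slice_comm_gD_gN (k m : Fin p → ℕ) (S : Finset (Fin p)) :
    Matrix.of (slice K k m (gD K S)) * Matrix.of (slice K k m (gN K S)) -
        Matrix.of (slice K k m (gN K S)) * Matrix.of (slice K k m (gD K S)) =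
      Matrix.of (slice K k m (gN K S)) := by
  classical
  rw [slice_gD_diag]
  ext x x'
  simp only [Matrix.sub_apply, diagonal_mul, mul_diagonal, of_apply, slice_gN_apply]
  by_cases hc : (x.1 = x'.1 ∧ (x.2.2 : ℕ) = x'.2.2) ∧ (x.1 ∈ S ∧ (x.2.1 : ℕ) = x'.2.1 + 1)
  · have hx'S : x'.1 ∈ S := hc.1.1 ▸ hc.2.1
    rw [if_pos hc, if_pos hc.2.1, if_pos hx'S, hc.2.2]
    push_cast
    ring
  · rw [if_neg hc, mul_zero, zero_mul, sub_zero]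

/-! ## §3 The shift floor and the uniform `4/3` floor -/

/-- **THE SHIFT FLOOR**: `2∑ᵢ kᵢmᵢ + ∑_{i∈S} (kᵢ − 1)mᵢ ≤ 2R̲(⊕ᵢ ⟨kᵢ,mᵢ,kᵢ⟩)` over every field, for every
set `S` of blocks (Strassen's equation BCS (19.12) with `A = 1`, `B = D`, `C = N`: the commutator is the
shift slice, of rank `≥ rk(N Nᵀ) = ∑_{i∈S}(kᵢ−1)mᵢ`). [cite: BurgisserClausenShokrollahi1997, Thm. (19.12)] -/
theorem floor_shift (k m : Fin p → ℕ) (S : Finset (Fin p)) :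
    2 * ∑ i, k i * m i + ∑ i ∈ S, (k i - 1) * m i ≤ 2 * algBorderRank (matMulDirectSum K k m k) := by
  classical
  set tab : Fin 3 → Fin p → ℕ → ℕ → K := ![gId K, gD K S, gN K S] with htab
  set t : Fin 3 → (Σ i, Fin (k i) × Fin (m i)) → (Σ i, Fin (k i) × Fin (m i)) → K :=
    fun j => slice K k m (tab j) with ht
  have hle : algBorderRank t ≤ algBorderRank (matMulDirectSum K k m k) :=
    algBorderRank_slices_le K k m tab
  have h0 : Matrix.of (t 0) = 1 := slice_gId K k m
  have h1 : t 1 = slice K k m (gD K S) := rfl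
  have h2 : t 2 = slice K k m (gN K S) := rfl
  have hBCS := BCS1997_thm_19_12 t 0 1 2 (by rw [h0, det_one]; exact isUnit_one)
  rw [h0, inv_one, Matrix.mul_one, Matrix.mul_one, h1, h2, slice_comm_gD_gN] at hBCS
  -- rank of the shift slice ≥ rank of `N Nᵀ` = number of rows `κ ≥ 1` in the selected blocks
  set w : (Σ i, Fin (k i) × Fin (m i)) → K :=
    fun x => if x.1 ∈ S ∧ 1 ≤ (x.2.1 : ℕ) then (1 : K) else 0 with hw
  have hrk : (diagonal w).rank ≤ (Matrix.of (slice K k m (gN K S))).rank := by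
    rw [← slice_gN_mul_gNt]
    exact Matrix.rank_mul_le_left _ _
  set c : Fin p → ℕ := fun i => if i ∈ S then k i - 1 else 0 with hc
  have hcS : ∀ y : (Σ i, Fin (c i) × Fin (m i)), y.1 ∈ S := by
    intro y
    by_contra hy
    have := y.2.1.isLt
    simp [hc, hy] at this
  have hclt : ∀ y : (Σ i, Fin (c i) × Fin (m i)), (y.2.1 : ℕ) + 1 < k y.1 := by
    intro y
    have hy := hcS y
    have := y.2.1.isLt
    simp only [hc, hy, if_true] at this
    omega
  have hwne : ∀ y : (Σ i, Fin (c i) × Fin (m i)),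
      w ⟨y.1, (⟨(y.2.1 : ℕ) + 1, hclt y⟩, y.2.2)⟩ ≠ 0 := by
    intro y
    have hy := hcS y
    simp [hw, hy]
  set φ : (Σ i, Fin (c i) × Fin (m i)) → {x : (Σ i, Fin (k i) × Fin (m i)) // w x ≠ 0} :=
    fun y => ⟨⟨y.1, (⟨(y.2.1 : ℕ) + 1, hclt y⟩, y.2.2)⟩, hwne y⟩ with hφ
  have hφinj : Function.Injective φ := by
    intro y y' h
    have h' : (⟨y.1, (⟨(y.2.1 : ℕ) + 1, hclt y⟩, y.2.2)⟩ : Σ i, Fin (k i) × Fin (m i)) =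
        ⟨y'.1, (⟨(y'.2.1 : ℕ) + 1, hclt y'⟩, y'.2.2)⟩ := congrArg Subtype.val h
    obtain ⟨e1, e2, e3⟩ := (sigma_eq_iff _ _).1 h'
    have e2' : (y.2.1 : ℕ) = y'.2.1 := by simpa using e2
    exact (sigma_eq_iff y y').2 ⟨e1, e2', e3⟩
  have hcard : Fintype.card (Σ i, Fin (c i) × Fin (m i)) = ∑ i ∈ S, (k i - 1) * m i := by
    simp only [Fintype.card_sigma, Fintype.card_prod, Fintype.card_fin, hc, ite_mul, zero_mul]
    exact Fintype.sum_ite_mem S (fun i => (k i - 1) * m i)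
  have hsub : ∑ i ∈ S, (k i - 1) * m i ≤ (diagonal w).rank := by
    rw [Matrix.rank_diagonal, ← hcard]
    exact Fintype.card_le_of_injective φ hφinj
  have hX : Fintype.card (Σ i, Fin (k i) × Fin (m i)) = ∑ i, k i * m i := by
    simp [Fintype.card_prod]
  omega

/-- **THE UNIFORM FLOOR `4L ≤ 3R̲`**: if every block is genuine (`kᵢ ≥ 2`) then
`4∑ᵢ kᵢmᵢ ≤ 3·R̲(⊕ᵢ ⟨kᵢ,mᵢ,kᵢ⟩)` — the unit-pair floor `L + ∑mᵢ ≤ R̲` (kernel XXXIX-A) plus the shift floor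
`2L + ∑(kᵢ−1)mᵢ ≤ 2R̲`.  Border rank ≥ `4/3` of the `x`-count, uniformly in the widths, over every field.
[cite: BurgisserClausenShokrollahi1997, Thm. (19.12)] -/
theorem uniform_floor (k m : Fin p → ℕ) (hk : ∀ i, 2 ≤ k i) :
    4 * ∑ i, k i * m i ≤ 3 * algBorderRank (matMulDirectSum K k m k) := by
  classical
  have hA := floor K k m Finset.univ (fun i _ => hk i)
  have hB := floor_shift K k m Finset.univ
  have hsum : ∑ i, (k i - 1) * m i + ∑ i, m i = ∑ i, k i * m i := by
    rw [← Finset.sum_add_distrib]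
    refine Finset.sum_congr rfl fun i _ => ?_
    have h1 : 1 ≤ k i := le_trans (by norm_num) (hk i)
    calc (k i - 1) * m i + m i = (k i - 1) * m i + 1 * m i := by rw [one_mul]
      _ = (k i - 1 + 1) * m i := (add_mul _ _ _).symm
      _ = k i * m i := by rw [Nat.sub_add_cancel h1]
  omega

end Summit.MatrixMultiplication.MatrixMultiplication.Theorems.FarEdgeDescentStrassenFloorShift

end
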